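import Literature.NumberTheory.LFunctions.Zhang2022.RepairBoxPrimitives

/-!
# Zhang (2022) §18-margin repair rung: slope arithmetic (centred forms) over the box primitives

Trunk T-ANT (NumberTheory/LFunctions). Infrastructure for the LOCAL cover annex of the
REPAIR-or-BARRIER rung (D-0077) on Y. Zhang, arXiv:2211.02515v1 [Zhang2022LandauSiegel].
`RepairBoxPrimitives` / `RepairSection9Boxes` evaluate the closed forms of the margin's matrix
entries by the NATURAL interval extension; measured over a length box of width `h` the enclosure
of an entry is `≈ 97·h` wide (true variation `≈ 10·h`), while the entry tolerance of the leaf tests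
is `≈ 10⁻⁴` — so naive leaves must be `≲ 10⁻⁶` wide. This file provides first-order CENTRED forms by
Krawczyk–Neumaier SLOPE ARITHMETIC in one active real variable `t` (the other parameters enter as
constant boxes): a slope form `Z = (rng, ctr, slp)` for `f` on the interval `T` about the rational
centre `c` means `f(T) ⊆ rng`, `f(c) ∈ ctr`, and `f(t) − f(c) = s·(t − c)` with `s ∈ slp` for every
`t ∈ T`; then `f(t) ∈ ctr + slp·(T − c)` (`mem_encl`), whose width is (true slope + O(h))·h. The
rules are ALGEBRAIC IDENTITIES (no derivatives, no mean-value theorem):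
`fg(t) − fg(c) = (f(t) − f(c))g(t) + f(c)(g(t) − g(c))`, `1/f(t) − 1/f(c) = −(f(t) − f(c))/(f(t)f(c))`,
and for the oscillatory factor `e^{ia(t)} − e^{ia(c)} = e^{ia(c)}·φ·(a(t) − a(c))` with
`|φ − i| ≤ |a(t) − a(c)| ≤ 1` (`Complex.norm_exp_sub_one_sub_id_le`).

* `SFI` (real) / `SCB` (complex) slope forms, `SFI.Mem T c f Z` / `SCB.Mem T c f Z`;
* rules with soundness lemmas: `const`, `var`, `add`, `sub`, `neg`, `mul`, `scaleRat`, `recip`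
  (flag `recipSOK`) for `SFI`; `ofReal`, `const`, `add`, `sub`, `neg`, `conj`, `mulI`, `mulInt`,
  `mul`, `mulR` (by a real slope form), `expI` (flag `expISOK`) for `SCB`;
* `SFI.encl`, `SCB.encl` and `mem_encl`: the centred-form enclosure of `f(t)` for `t ∈ T`.

No statement about the manuscript; no facts, no axioms beyond the standard three.

## References
* R. Krawczyk, A. Neumaier, *Interval slopes for rational functions and associated centered
  forms*, SIAM J. Numer. Anal. 22 (1985) 604–616; A. Neumaier, *Interval methods for systems of
  equations*, CUP 1990, §2.3. [folklore; cited as Moore1966 §4.4 for the centred form]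
-/

noncomputable section

open Complex Real
open Literature.Analysis.ValidatedNumerics.Numerics

namespace Literature.NumberTheory.LFunctions.Zhang2022

/-! ### Real slope forms -/

/-- A real slope form on an interval `T` about a centre `c`: range, value at the centre, slope.
[cite: Moore1966, §4.4] -/
structure SFI where
  /-- enclosure of `f(T)` -/
  rng : FI
  /-- enclosure of `f(c)` -/
  ctr : FI
  /-- enclosure of the slopes `(f(t) − f(c))/(t − c)`, `t ∈ T` -/
  slp : FI

/-- `Z` is a slope form of the real function `f` on `T` about `c`. [cite: Moore1966, §4.4] -/
def SFI.Mem (T : FI) (c : ℚ) (f : ℝ → ℝ) (Z : SFI) : Prop :=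
  (∀ t, FI.mem t T → FI.mem (f t) Z.rng) ∧ FI.mem (f c) Z.ctr ∧
    ∀ t, FI.mem t T → ∃ s : ℝ, FI.mem s Z.slp ∧ f t - f c = s * (t - c)

namespace SFI

variable {T : FI} {c : ℚ} {f g : ℝ → ℝ} {Z W : SFI}

/-- constant (with an interval of values): slope `0`. [cite: Moore1966, §4.4] -/
def const (X : FI) : SFI := ⟨X, X, FI.ofInt 0⟩

/-- the active variable `t ↦ t`: slope `1`. [cite: Moore1966, §4.4] -/
def var (T : FI) (c : ℚ) : SFI := ⟨T, FI.ofRat c, FI.ofInt 1⟩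

/-- sum [cite: Moore1966, §4.4] -/
def add (Z W : SFI) : SFI := ⟨Z.rng.add W.rng, Z.ctr.add W.ctr, Z.slp.add W.slp⟩
/-- difference [cite: Moore1966, §4.4] -/
def sub (Z W : SFI) : SFI := ⟨Z.rng.sub W.rng, Z.ctr.sub W.ctr, Z.slp.sub W.slp⟩
/-- negation [cite: Moore1966, §4.4] -/
def neg (Z : SFI) : SFI := ⟨Z.rng.neg, Z.ctr.neg, Z.slp.neg⟩
/-- product: slope `s_f·g(T) + f(c)·s_g`. [cite: Moore1966, §4.4] -/
def mul (Z W : SFI) : SFI :=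
  ⟨Z.rng.mul W.rng, Z.ctr.mul W.ctr, (Z.slp.mul W.rng).add (Z.ctr.mul W.slp)⟩
/-- product with a rational constant [cite: Moore1966, §4.4] -/
def scaleRat (Z : SFI) (q : ℚ) : SFI := ⟨scaleRatFI Z.rng q, scaleRatFI Z.ctr q, scaleRatFI Z.slp q⟩
/-- reciprocal: slope `−s_f/(f(T)f(c))` (junk unless `recipSOK`). [cite: Moore1966, §4.4] -/
def recip (Z : SFI) : SFI :=
  ⟨recipFI Z.rng, recipFI Z.ctr, ((Z.slp.mul (recipFI Z.rng)).mul (recipFI Z.ctr)).neg⟩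
/-- validity flag of `recip` [folklore] -/
def recipSOK (Z : SFI) : Bool := recipOK Z.rng && recipOK Z.ctr

/-- the centred-form enclosure `ctr + slp·(T − c)` of `f(t)`, `t ∈ T`. [cite: Moore1966, §4.4] -/
def encl (Z : SFI) (T : FI) (c : ℚ) : FI := Z.ctr.add (Z.slp.mul (T.sub (FI.ofRat c)))

/-- soundness of `const` [cite: Moore1966, §4.4] -/
theorem mem_const {x : ℝ} {X : FI} (hx : FI.mem x X) : SFI.Mem T c (fun _ => x) (const X) :=
  ⟨fun _ _ => hx, hx, fun t _ => ⟨0, by simpa [const] using FI.mem_ofInt 0, by simp⟩⟩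

/-- soundness of `var` [cite: Moore1966, §4.4] -/
theorem mem_var : SFI.Mem T c (fun t => t) (var T c) :=
  ⟨fun _ ht => ht, by simpa [var] using FI.mem_ofRat c,
    fun t _ => ⟨1, by simpa [var] using FI.mem_ofInt 1, by simp⟩⟩

/-- soundness of `add` [cite: Moore1966, §4.4] -/
theorem mem_add (hf : SFI.Mem T c f Z) (hg : SFI.Mem T c g W) :
    SFI.Mem T c (fun t => f t + g t) (add Z W) := by
  refine ⟨fun t ht => FI.mem_add (hf.1 t ht) (hg.1 t ht), FI.mem_add hf.2.1 hg.2.1, fun t ht => ?_⟩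
  obtain ⟨s, hs, es⟩ := hf.2.2 t ht
  obtain ⟨r, hr, er⟩ := hg.2.2 t ht
  exact ⟨s + r, FI.mem_add hs hr, by rw [add_mul, ← es, ← er]; ring⟩

/-- soundness of `sub` [cite: Moore1966, §4.4] -/
theorem mem_sub (hf : SFI.Mem T c f Z) (hg : SFI.Mem T c g W) :
    SFI.Mem T c (fun t => f t - g t) (sub Z W) := by
  refine ⟨fun t ht => FI.mem_sub (hf.1 t ht) (hg.1 t ht), FI.mem_sub hf.2.1 hg.2.1, fun t ht => ?_⟩
  obtain ⟨s, hs, es⟩ := hf.2.2 t ht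
  obtain ⟨r, hr, er⟩ := hg.2.2 t ht
  exact ⟨s - r, FI.mem_sub hs hr, by rw [sub_mul, ← es, ← er]; ring⟩

/-- soundness of `neg` [cite: Moore1966, §4.4] -/
theorem mem_neg (hf : SFI.Mem T c f Z) : SFI.Mem T c (fun t => -f t) (neg Z) := by
  refine ⟨fun t ht => FI.mem_neg (hf.1 t ht), FI.mem_neg hf.2.1, fun t ht => ?_⟩
  obtain ⟨s, hs, es⟩ := hf.2.2 t ht
  exact ⟨-s, FI.mem_neg hs, by rw [neg_mul, ← es]; ring⟩

/-- soundness of `mul`: `fg(t) − fg(c) = (f(t) − f(c))g(t) + f(c)(g(t) − g(c))`. [cite: Moore1966, §4.4] -/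
theorem mem_mul (hf : SFI.Mem T c f Z) (hg : SFI.Mem T c g W) :
    SFI.Mem T c (fun t => f t * g t) (mul Z W) := by
  refine ⟨fun t ht => FI.mem_mul (hf.1 t ht) (hg.1 t ht), FI.mem_mul hf.2.1 hg.2.1, fun t ht => ?_⟩
  obtain ⟨s, hs, es⟩ := hf.2.2 t ht
  obtain ⟨r, hr, er⟩ := hg.2.2 t ht
  refine ⟨s * g t + f c * r, FI.mem_add (FI.mem_mul hs (hg.1 t ht)) (FI.mem_mul hf.2.1 hr), ?_⟩
  have e1 : f t * g t - f c * g c = (f t - f c) * g t + f c * (g t - g c) := by ring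
  rw [e1, es, er]; ring

/-- soundness of `scaleRat` [cite: Moore1966, §4.4] -/
theorem mem_scaleRat (hf : SFI.Mem T c f Z) (q : ℚ) :
    SFI.Mem T c (fun t => (q : ℝ) * f t) (scaleRat Z q) := by
  refine ⟨fun t ht => mem_scaleRatFI (hf.1 t ht) q, mem_scaleRatFI hf.2.1 q, fun t ht => ?_⟩
  obtain ⟨s, hs, es⟩ := hf.2.2 t ht
  exact ⟨(q : ℝ) * s, mem_scaleRatFI hs q, by rw [← mul_sub, es]; ring⟩

/-- an interval with the `recipOK` flag does not contain `0`. [cite: Moore1966, Theorem 3.1] -/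
theorem ne_zero_of_recipOK {x : ℝ} {X : FI} (h : recipOK X = true) (hx : FI.mem x X) : x ≠ 0 := by
  unfold recipOK at h
  have hS := SC_pos
  by_cases hs : 0 < X.lo
  · have h1 : (0 : ℝ) < X.lo := by exact_mod_cast hs
    have : 0 < x * SC := lt_of_lt_of_le h1 hx.1
    intro h0; rw [h0, zero_mul] at this; exact lt_irrefl _ this
  · rw [if_neg hs] at h
    unfold FI.divPos at h
    by_cases hn : 0 < X.neg.lo
    · have h1 : (0 : ℝ) < X.neg.lo := by exact_mod_cast hn
      have h2 := (FI.mem_neg hx).1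
      have : 0 < -x * SC := lt_of_lt_of_le h1 h2
      intro h0; rw [h0, neg_zero, zero_mul] at this; exact lt_irrefl _ this
    · rw [if_neg hn] at h; simp at h

/-- soundness of `recip`: `1/f(t) − 1/f(c) = −(f(t) − f(c))/(f(t)f(c))`. [cite: Moore1966, §4.4] -/
theorem mem_recip (hf : SFI.Mem T c f Z) (h : recipSOK Z = true) :
    SFI.Mem T c (fun t => 1 / f t) (recip Z) := by
  simp only [recipSOK, Bool.and_eq_true] at h
  refine ⟨fun t ht => mem_recipFI h.1 (hf.1 t ht), mem_recipFI h.2 hf.2.1, fun t ht => ?_⟩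
  obtain ⟨s, hs, es⟩ := hf.2.2 t ht
  have hft : f t ≠ 0 := ne_zero_of_recipOK h.1 (hf.1 t ht)
  have hfc : f c ≠ 0 := ne_zero_of_recipOK h.2 hf.2.1
  refine ⟨-(s * (1 / f t) * (1 / f c)), FI.mem_neg (FI.mem_mul (FI.mem_mul hs
    (mem_recipFI h.1 (hf.1 t ht))) (mem_recipFI h.2 hf.2.1)), ?_⟩
  field_simp
  linear_combination (-1 : ℝ) * es

/-- **The centred-form enclosure**: `f(t) ∈ ctr + slp·(T − c)` for `t ∈ T`. [cite: Moore1966, §4.4] -/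
theorem mem_encl (hf : SFI.Mem T c f Z) {t : ℝ} (ht : FI.mem t T) : FI.mem (f t) (encl Z T c) := by
  obtain ⟨s, hs, es⟩ := hf.2.2 t ht
  have e : f t = f c + s * (t - c) := by rw [← es]; ring
  rw [e]
  exact FI.mem_add hf.2.1 (FI.mem_mul hs (FI.mem_sub ht (FI.mem_ofRat c)))

end SFI

/-! ### Complex slope forms -/

/-- A complex slope form on an interval `T` about a centre `c`. [cite: Moore1966, §4.4] -/
structure SCB where
  /-- enclosure of `f(T)` -/
  rng : CB
  /-- enclosure of `f(c)` -/
  ctr : CB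
  /-- enclosure of the slopes `(f(t) − f(c))/(t − c)`, `t ∈ T` -/
  slp : CB

/-- `Z` is a slope form of the complex function `f` on `T` about `c`. [cite: Moore1966, §4.4] -/
def SCB.Mem (T : FI) (c : ℚ) (f : ℝ → ℂ) (Z : SCB) : Prop :=
  (∀ t, FI.mem t T → CB.mem (f t) Z.rng) ∧ CB.mem (f c) Z.ctr ∧
    ∀ t, FI.mem t T → ∃ s : ℂ, CB.mem s Z.slp ∧ f t - f c = s * ((t - c : ℝ) : ℂ)

namespace SCB

variable {T : FI} {c : ℚ} {f g : ℝ → ℂ} {a : ℝ → ℝ} {Z W : SCB} {A : SFI}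

/-- a real slope form as a complex one [cite: Moore1966, §4.4] -/
def ofReal (A : SFI) : SCB := ⟨CB.ofFI A.rng, CB.ofFI A.ctr, CB.ofFI A.slp⟩
/-- constant (with a box of values): slope `0` [cite: Moore1966, §4.4] -/
def const (X : CB) : SCB := ⟨X, X, CB.ofInt 0⟩
/-- sum [cite: Moore1966, §4.4] -/
def add (Z W : SCB) : SCB := ⟨Z.rng.add W.rng, Z.ctr.add W.ctr, Z.slp.add W.slp⟩
/-- difference [cite: Moore1966, §4.4] -/
def sub (Z W : SCB) : SCB := ⟨Z.rng.sub W.rng, Z.ctr.sub W.ctr, Z.slp.sub W.slp⟩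
/-- negation [cite: Moore1966, §4.4] -/
def neg (Z : SCB) : SCB := ⟨Z.rng.neg, Z.ctr.neg, Z.slp.neg⟩
/-- complex conjugation (the variable is real, so slopes conjugate) [cite: Moore1966, §4.4] -/
def conj (Z : SCB) : SCB := ⟨Z.rng.conj, Z.ctr.conj, Z.slp.conj⟩
/-- product with `i` [cite: Moore1966, §4.4] -/
def mulI (Z : SCB) : SCB := ⟨Z.rng.mulI, Z.ctr.mulI, Z.slp.mulI⟩
/-- product with an integer [cite: Moore1966, §4.4] -/
def mulInt (Z : SCB) (k : ℤ) : SCB := ⟨Z.rng.mulInt k, Z.ctr.mulInt k, Z.slp.mulInt k⟩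
/-- product: slope `s_f·g(T) + f(c)·s_g` [cite: Moore1966, §4.4] -/
def mul (Z W : SCB) : SCB :=
  ⟨Z.rng.mul W.rng, Z.ctr.mul W.ctr, (Z.slp.mul W.rng).add (Z.ctr.mul W.slp)⟩
/-- product with a real slope form [cite: Moore1966, §4.4] -/
def mulR (Z : SCB) (A : SFI) : SCB :=
  ⟨Z.rng.mulFI A.rng, Z.ctr.mulFI A.ctr, (Z.slp.mulFI A.rng).add (Z.ctr.mulFI A.slp)⟩

/-- bound `m·2^48 ≥ |a(t) − a(c)|·2^48` for the oscillatory rule: `absHi (slp·(T − c))`. [folklore] -/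
def oscBound (A : SFI) (T : FI) (c : ℚ) : ℤ := (A.slp.mul (T.sub (FI.ofRat c))).absHi
/-- the box `{φ : |Re φ| ≤ m, |Im φ − 1| ≤ m}` around `i` [folklore] -/
def phiBox (mS : ℤ) : CB := ⟨⟨-mS, mS⟩, ⟨(SC : ℤ) - mS, (SC : ℤ) + mS⟩⟩
/-- `e^{ia}` of a real slope form: range and centre by `CB.expI`, slope `e^{ia(c)}·φ·s_a`
(junk unless `expISOK`). [cite: Moore1966, §4.4] -/
def expI (A : SFI) (T : FI) (c : ℚ) : SCB :=
  ⟨(CB.expI A.rng).getD (CB.ofInt 0), (CB.expI A.ctr).getD (CB.ofInt 0),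
    (((CB.expI A.ctr).getD (CB.ofInt 0)).mul (phiBox (oscBound A T c))).mulFI A.slp⟩
/-- validity flag of `expI`: both exponentials evaluate and `m ≤ 1`. [folklore] -/
def expISOK (A : SFI) (T : FI) (c : ℚ) : Bool :=
  (CB.expI A.rng).isSome && (CB.expI A.ctr).isSome && decide (oscBound A T c ≤ (SC : ℤ))

/-- the centred-form enclosure `ctr + slp·(T − c)` [cite: Moore1966, §4.4] -/
def encl (Z : SCB) (T : FI) (c : ℚ) : CB := Z.ctr.add (Z.slp.mulFI (T.sub (FI.ofRat c)))

/-- soundness of `ofReal` [cite: Moore1966, §4.4] -/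
theorem mem_ofReal (ha : SFI.Mem T c a A) : SCB.Mem T c (fun t => (a t : ℂ)) (ofReal A) := by
  refine ⟨fun t ht => CB.mem_ofFI (ha.1 t ht), CB.mem_ofFI ha.2.1, fun t ht => ?_⟩
  obtain ⟨s, hs, es⟩ := ha.2.2 t ht
  exact ⟨(s : ℂ), CB.mem_ofFI hs, by rw [← Complex.ofReal_sub, es]; push_cast; ring⟩

/-- soundness of `const` [cite: Moore1966, §4.4] -/
theorem mem_const {z : ℂ} {X : CB} (hz : CB.mem z X) : SCB.Mem T c (fun _ => z) (const X) :=
  ⟨fun _ _ => hz, hz, fun t _ => ⟨0, by simpa [const] using CB.mem_ofInt 0, by simp⟩⟩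

/-- soundness of `add` [cite: Moore1966, §4.4] -/
theorem mem_add (hf : SCB.Mem T c f Z) (hg : SCB.Mem T c g W) :
    SCB.Mem T c (fun t => f t + g t) (add Z W) := by
  refine ⟨fun t ht => CB.mem_add (hf.1 t ht) (hg.1 t ht), CB.mem_add hf.2.1 hg.2.1, fun t ht => ?_⟩
  obtain ⟨s, hs, es⟩ := hf.2.2 t ht
  obtain ⟨r, hr, er⟩ := hg.2.2 t ht
  exact ⟨s + r, CB.mem_add hs hr, by rw [add_mul, ← es, ← er]; ring⟩

/-- soundness of `sub` [cite: Moore1966, §4.4] -/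
theorem mem_sub (hf : SCB.Mem T c f Z) (hg : SCB.Mem T c g W) :
    SCB.Mem T c (fun t => f t - g t) (sub Z W) := by
  refine ⟨fun t ht => CB.mem_sub (hf.1 t ht) (hg.1 t ht), CB.mem_sub hf.2.1 hg.2.1, fun t ht => ?_⟩
  obtain ⟨s, hs, es⟩ := hf.2.2 t ht
  obtain ⟨r, hr, er⟩ := hg.2.2 t ht
  exact ⟨s - r, CB.mem_sub hs hr, by rw [sub_mul, ← es, ← er]; ring⟩

/-- soundness of `neg` [cite: Moore1966, §4.4] -/
theorem mem_neg (hf : SCB.Mem T c f Z) : SCB.Mem T c (fun t => -f t) (neg Z) := by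
  refine ⟨fun t ht => CB.mem_neg (hf.1 t ht), CB.mem_neg hf.2.1, fun t ht => ?_⟩
  obtain ⟨s, hs, es⟩ := hf.2.2 t ht
  exact ⟨-s, CB.mem_neg hs, by rw [neg_mul, ← es]; ring⟩

/-- soundness of `conj` [cite: Moore1966, §4.4] -/
theorem mem_conj (hf : SCB.Mem T c f Z) :
    SCB.Mem T c (fun t => (starRingEnd ℂ) (f t)) (conj Z) := by
  refine ⟨fun t ht => CB.mem_conj (hf.1 t ht), CB.mem_conj hf.2.1, fun t ht => ?_⟩
  obtain ⟨s, hs, es⟩ := hf.2.2 t ht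
  refine ⟨(starRingEnd ℂ) s, CB.mem_conj hs, ?_⟩
  rw [← map_sub, es, map_mul, Complex.conj_ofReal]

/-- soundness of `mulI` [cite: Moore1966, §4.4] -/
theorem mem_mulI (hf : SCB.Mem T c f Z) : SCB.Mem T c (fun t => f t * I) (mulI Z) := by
  refine ⟨fun t ht => CB.mem_mulI (hf.1 t ht), CB.mem_mulI hf.2.1, fun t ht => ?_⟩
  obtain ⟨s, hs, es⟩ := hf.2.2 t ht
  exact ⟨s * I, CB.mem_mulI hs, by rw [← sub_mul, es]; ring⟩

/-- soundness of `mulInt` [cite: Moore1966, §4.4] -/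
theorem mem_mulInt (hf : SCB.Mem T c f Z) (k : ℤ) :
    SCB.Mem T c (fun t => f t * (k : ℂ)) (mulInt Z k) := by
  refine ⟨fun t ht => CB.mem_mulInt (hf.1 t ht) k, CB.mem_mulInt hf.2.1 k, fun t ht => ?_⟩
  obtain ⟨s, hs, es⟩ := hf.2.2 t ht
  exact ⟨s * (k : ℂ), CB.mem_mulInt hs k, by rw [← sub_mul, es]; ring⟩

/-- soundness of `mul` [cite: Moore1966, §4.4] -/
theorem mem_mul (hf : SCB.Mem T c f Z) (hg : SCB.Mem T c g W) :
    SCB.Mem T c (fun t => f t * g t) (mul Z W) := by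
  refine ⟨fun t ht => CB.mem_mul (hf.1 t ht) (hg.1 t ht), CB.mem_mul hf.2.1 hg.2.1, fun t ht => ?_⟩
  obtain ⟨s, hs, es⟩ := hf.2.2 t ht
  obtain ⟨r, hr, er⟩ := hg.2.2 t ht
  refine ⟨s * g t + f c * r, CB.mem_add (CB.mem_mul hs (hg.1 t ht)) (CB.mem_mul hf.2.1 hr), ?_⟩
  have e1 : f t * g t - f c * g c = (f t - f c) * g t + f c * (g t - g c) := by ring
  rw [e1, es, er]; ring

/-- soundness of `mulR` [cite: Moore1966, §4.4] -/
theorem mem_mulR (hf : SCB.Mem T c f Z) (ha : SFI.Mem T c a A) :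
    SCB.Mem T c (fun t => f t * (a t : ℂ)) (mulR Z A) := by
  refine ⟨fun t ht => CB.mem_mulFI (hf.1 t ht) (ha.1 t ht), CB.mem_mulFI hf.2.1 ha.2.1,
    fun t ht => ?_⟩
  obtain ⟨s, hs, es⟩ := hf.2.2 t ht
  obtain ⟨r, hr, er⟩ := ha.2.2 t ht
  refine ⟨s * (a t : ℂ) + f c * (r : ℂ),
    CB.mem_add (CB.mem_mulFI hs (ha.1 t ht)) (CB.mem_mulFI hf.2.1 hr), ?_⟩
  have e1 : f t * (a t : ℂ) - f c * (a c : ℂ) = (f t - f c) * a t + f c * ((a t - a c : ℝ) : ℂ) := by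
    push_cast; ring
  rw [e1, es, er]; push_cast; ring

/-- The oscillatory factor: for real `δ` with `|δ| ≤ m ≤ 1` there is `φ` with `|Re φ| ≤ m`,
`|Im φ − 1| ≤ m` and `e^{iδ} − 1 = δφ` (`φ = (e^{iδ} − 1)/δ`, `|φ − i| ≤ |δ|` from
`‖e^{x} − 1 − x‖ ≤ ‖x‖²`, `‖x‖ ≤ 1`). [cite: Moore1966, §4.4] -/
theorem exists_phi_of_abs_le {δ m : ℝ} (hδ : |δ| ≤ m) (hm : m ≤ 1) :
    ∃ φ : ℂ, |φ.re| ≤ m ∧ |φ.im - 1| ≤ m ∧ cexp ((δ : ℂ) * I) - 1 = (δ : ℂ) * φ := by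
  by_cases h0 : δ = 0
  · refine ⟨I, ?_, ?_, ?_⟩
    · simp; exact le_trans (abs_nonneg δ) hδ
    · simp; exact le_trans (abs_nonneg δ) hδ
    · rw [h0]; simp
  · refine ⟨(cexp ((δ : ℂ) * I) - 1) / δ, ?_, ?_, ?_⟩
    · have hn : ‖(cexp ((δ : ℂ) * I) - 1) / δ - I‖ ≤ m := by
        have hx : ‖(δ : ℂ) * I‖ ≤ 1 := by
          rw [norm_mul, Complex.norm_I, mul_one, Complex.norm_real]; exact le_trans hδ hm
        have h1 := Complex.norm_exp_sub_one_sub_id_le hx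
        have hδ0 : (δ : ℂ) ≠ 0 := by exact_mod_cast h0
        have e : (cexp ((δ : ℂ) * I) - 1) / δ - I = (cexp ((δ : ℂ) * I) - 1 - δ * I) / δ := by
          field_simp
        rw [e, norm_div, Complex.norm_real]
        rw [norm_mul, Complex.norm_I, mul_one, Complex.norm_real, Real.norm_eq_abs] at h1
        rw [Real.norm_eq_abs, div_le_iff₀ (abs_pos.2 h0)]
        calc ‖cexp ((δ : ℂ) * I) - 1 - δ * I‖ ≤ |δ| ^ 2 := h1
          _ = |δ| * |δ| := by ring
          _ ≤ m * |δ| := by gcongr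
      have := Complex.abs_re_le_norm ((cexp ((δ : ℂ) * I) - 1) / δ - I)
      simp only [Complex.sub_re, Complex.I_re, sub_zero] at this
      exact le_trans this hn
    · have hn : ‖(cexp ((δ : ℂ) * I) - 1) / δ - I‖ ≤ m := by
        have hx : ‖(δ : ℂ) * I‖ ≤ 1 := by
          rw [norm_mul, Complex.norm_I, mul_one, Complex.norm_real]; exact le_trans hδ hm
        have h1 := Complex.norm_exp_sub_one_sub_id_le hx
        have hδ0 : (δ : ℂ) ≠ 0 := by exact_mod_cast h0
        have e : (cexp ((δ : ℂ) * I) - 1) / δ - I = (cexp ((δ : ℂ) * I) - 1 - δ * I) / δ := by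
          field_simp
        rw [e, norm_div, Complex.norm_real]
        rw [norm_mul, Complex.norm_I, mul_one, Complex.norm_real, Real.norm_eq_abs] at h1
        rw [Real.norm_eq_abs, div_le_iff₀ (abs_pos.2 h0)]
        calc ‖cexp ((δ : ℂ) * I) - 1 - δ * I‖ ≤ |δ| ^ 2 := h1
          _ = |δ| * |δ| := by ring
          _ ≤ m * |δ| := by gcongr
      have := Complex.abs_im_le_norm ((cexp ((δ : ℂ) * I) - 1) / δ - I)
      simp only [Complex.sub_im, Complex.I_im] at this
      exact le_trans this hn
    · have hδ0 : (δ : ℂ) ≠ 0 := by exact_mod_cast h0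
      field_simp

/-- membership in `phiBox`. [cite: Moore1966, Theorem 3.1] -/
theorem mem_phiBox {φ : ℂ} {mS : ℤ} (h1 : |φ.re| * SC ≤ (mS : ℝ)) (h2 : |φ.im - 1| * SC ≤ (mS : ℝ)) :
    CB.mem φ (phiBox mS) := by
  have hS := SC_pos
  rw [← abs_of_pos hS, ← abs_mul] at h1 h2
  rw [abs_le] at h1 h2
  refine ⟨⟨?_, ?_⟩, ⟨?_, ?_⟩⟩ <;> simp only [phiBox] <;> push_cast <;> nlinarith [h1.1, h1.2, h2.1, h2.2]

/-- soundness of `expI`: `e^{ia(t)} − e^{ia(c)} = e^{ia(c)}·φ·(a(t) − a(c))`. [cite: Moore1966, §4.4] -/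
theorem mem_expI (ha : SFI.Mem T c a A) (h : expISOK A T c = true) :
    SCB.Mem T c (fun t => cexp ((a t : ℂ) * I)) (expI A T c) := by
  simp only [expISOK, Bool.and_eq_true, decide_eq_true_eq] at h
  obtain ⟨⟨hR, hC⟩, hm⟩ := h
  cases hY : CB.expI A.rng with
  | none => rw [hY] at hR; simp at hR
  | some Y =>
  cases hYc : CB.expI A.ctr with
  | none => rw [hYc] at hC; simp at hC
  | some Yc =>
  have hrng : ∀ t, FI.mem t T → CB.mem (cexp ((a t : ℂ) * I)) Y := fun t ht => CB.mem_expI hY (ha.1 t ht)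
  have hctr : CB.mem (cexp ((a c : ℂ) * I)) Yc := CB.mem_expI hYc ha.2.1
  refine ⟨fun t ht => by simpa [expI, hY] using hrng t ht, by simpa [expI, hYc] using hctr,
    fun t ht => ?_⟩
  obtain ⟨s, hs, es⟩ := ha.2.2 t ht
  -- the phase increment `δ = a t − a c = s (t − c)` and its bound
  have hδmem : FI.mem (a t - a c) (A.slp.mul (T.sub (FI.ofRat c))) := by
    rw [es]; exact FI.mem_mul hs (FI.mem_sub ht (FI.mem_ofRat c))
  have hδabs := FI.abs_le_absHi hδmem
  have hS := SC_pos
  have hmR : ((oscBound A T c : ℤ) : ℝ) ≤ SC := by exact_mod_cast hm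
  obtain ⟨φ, hφ1, hφ2, hφe⟩ := exists_phi_of_abs_le (m := (oscBound A T c : ℝ) / SC)
    (by rw [le_div_iff₀ hS]; exact hδabs) (by rw [div_le_iff₀ hS, one_mul]; exact hmR)
  have hφ : CB.mem φ (phiBox (oscBound A T c)) :=
    mem_phiBox (by rw [← le_div_iff₀ hS]; exact hφ1) (by rw [← le_div_iff₀ hS]; exact hφ2)
  refine ⟨cexp ((a c : ℂ) * I) * φ * (s : ℂ), ?_, ?_⟩
  · simpa [expI, hYc] using CB.mem_mulFI (CB.mem_mul hctr hφ) hs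
  · have e1 : cexp ((a t : ℂ) * I) - cexp ((a c : ℂ) * I)
        = cexp ((a c : ℂ) * I) * (cexp (((a t - a c : ℝ) : ℂ) * I) - 1) := by
      rw [mul_sub, mul_one, ← Complex.exp_add]; push_cast; ring_nf
    rw [e1, hφe, es]; push_cast; ring

/-- **The centred-form enclosure** (complex): `f(t) ∈ ctr + slp·(T − c)` for `t ∈ T`. [cite: Moore1966, §4.4] -/
theorem mem_encl (hf : SCB.Mem T c f Z) {t : ℝ} (ht : FI.mem t T) : CB.mem (f t) (encl Z T c) := by
  obtain ⟨s, hs, es⟩ := hf.2.2 t ht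
  have e : f t = f c + s * ((t - c : ℝ) : ℂ) := by rw [← es]; ring
  rw [e]
  exact CB.mem_add hf.2.1 (CB.mem_mulFI hs (FI.mem_sub ht (FI.mem_ofRat c)))

/-- the range component alone is already an enclosure (used to INTERSECT information: a consumer
may take whichever of `rng`, `encl` is tighter per endpoint). [cite: Moore1966, Theorem 3.1] -/
theorem mem_rng (hf : SCB.Mem T c f Z) {t : ℝ} (ht : FI.mem t T) : CB.mem (f t) Z.rng := hf.1 t ht

end SCB

end Literature.NumberTheory.LFunctions.Zhang2022
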